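import Summits.Ventures.AbcSig.Recipes.BS04

/-!
# Venture AbcSig — kernel checker for EISENSTEIN CONGRUENCES of a newform orbit (cell module M6)

HONEST FRAMING. Certificate checker of a COMPUTATION cell (`pub-abcsig`). It proves NO Diophantine statement, makes no
claim on ABC or any summit, and does NOT verify the newform computation. The cell's module M6 removes a residual
exponent `n` of the trace sieve at an orbit `f` by exhibiting a prime `𝔫 = (n, θ − r)` of the Hecke order and an
Eisenstein series `G = Σ_t λ_t (E₂(z) − t E₂(tz))` (`t ∣ N`, `t > 1`) of weight 2 on `Γ₀(N)` with
`a_m(f) ≡ a_m(G) (mod 𝔫)` for all `m` up to the Sturm bound; by [Sturm 1987, Thm. 1] the congruence then holds for all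
`m`, so `c_p(f) ≡ 1 + p (mod 𝔫)` for every prime `p ∤ N`, `ρ̄_{f,𝔫}` is reducible (Brauer–Nesbitt + Chebotarev), and
`ρ̄_{f,𝔫}` cannot be the (irreducible, [BS04, Cor. 3.1]) mod-`n` representation of a Frey curve. THIS FILE checks the
FINITE part of that argument in the kernel and proves what the check means for an abstract newform model:

* `EisCert.check c N X` (Boolean, evaluated by `decide`): `X : OrbitData` lists `F` (`F(θ) = 0`) and entries
  `(p, d_p, g_p)` with `d_p · c_p(f) = g_p(θ)` for the primes `p ≤ B` (INCLUDING `p = 2` and `p ∣ N`); the certificate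
  `c` gives `n`, `r`, inverses `d_p⁻¹ (mod n)`, the combination `λ`, the bound `B` with the prime factorisation of `N`
  (so that `6·B ≥ ψ(N) = [SL₂(ℤ) : Γ₀(N)]`, i.e. `B ≥ kψ(N)/12` for weight `k = 2`) and of every `m ≤ B`. The check
  recomputes `a_m(f) (mod 𝔫)` from the eigenvalues by the newform recursions (`a_{p^{j+2}} = c_p a_{p^{j+1}} −
  [p ∤ N] p a_{p^j}`, multiplicativity) and compares with `a_m(G) = −24 Σ_t λ_t (σ(m) − t σ(m/t))`, `a_0(G) =
  Σ_t λ_t (1 − t) ≡ 0`.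
* `EisCert.check_sound`: if the check passes then for every newform `f` of the model carrying the data `X` with
  generator `θ` and every ring homomorphism `ψ : Coeff f → k` into a field of characteristic `n` with `ψ(θ) = r`, the
  model-side statement `M.EisensteinCongruent f ψ c.lam c.B` holds (the images under `ψ` of the recursively defined
  coefficients `coeffOfFac N (c_·(f)) (factorisation of m)` equal `a_m(G)` in `k` for all `1 ≤ m ≤ B`, and
  `a_0(G) = 0` in `k`), together with `SturmReaches N c.B`.

What is NOT here (deliberately, see the cell's plean/README "M6 design"): the CITED step (Sturm's theorem + reducibility
⇒ "does not arise") and its composition with the row templates; those take `EisensteinCongruent` as the interface.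
In the intended model `coeffOfFac N (c_·(f)) fac = a_m(f)` for the prime factorisation `fac` of `m` ([DS05, Prop.
5.8.5]: a normalised newform is a normalised eigenform of all `T_p`, `U_p`), and `psiOfFac` of the factorisation of `N`
is the index `ψ(N) = N ∏_{p ∣ N} (1 + 1/p)`.

References: J. Sturm, "On the congruence of modular forms", LNM 1240 (1987) 275–280, Thm. 1; W. Stein, "Modular Forms,
a Computational Approach" (2007), Thm. 9.18–Cor. 9.20; F. Diamond, J. Shurman, GTM 228 (2005), §4.5–4.6 (Eisenstein
series for `Γ₀(N)`), Prop. 5.8.5; [BS04] Bennett–Skinner, Canad. J. Math. 56 (2004), Cor. 3.1. Cell records: module M6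
= lead ruling R6 (PLAN §10 A5), certificates `census/rows/*/M6/M6_N<N>_<orbit>_n<n>_t<r>.json` (referee-verified with
`referee/refeis.py`).
-/

namespace Summit.Ventures.AbcSig

open Polynomial

/-! ## Horner evaluation of coefficient lists and its image under a ring homomorphism -/

/-- Horner evaluation of a little-endian integer coefficient list at an integer. -/
def hornerZ : List ℤ → ℤ → ℤ
  | [], _ => 0
  | a :: p, r => a + r * hornerZ p r

/-- `evalL θ [] = 0`. -/
lemma evalL_nil {R : Type} [CommRing R] (θ : R) : evalL θ [] = 0 := by
  simp [evalL]

/-- `evalL θ (a :: p) = a + θ · evalL θ p`. -/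
lemma evalL_cons {R : Type} [CommRing R] (θ : R) (a : ℤ) (p : List ℤ) :
    evalL θ (a :: p) = (a : R) + θ * evalL θ p := by
  unfold evalL
  rw [toPoly_cons, eval₂_add, eval₂_mul, eval₂_C, eval₂_X]
  simp

/-- A ring homomorphism `ψ` with `ψ(θ) = r` sends `P(θ)` to the integer `P(r)`. -/
lemma map_evalL_eq_hornerZ {R S : Type} [CommRing R] [CommRing S] (ψ : R →+* S) (θ : R) (r : ℤ)
    (hψ : ψ θ = (r : S)) : ∀ P : List ℤ, ψ (evalL θ P) = ((hornerZ P r : ℤ) : S)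
  | [] => by simp [evalL_nil, hornerZ]
  | a :: P => by
      rw [evalL_cons, map_add, map_mul, map_intCast, hψ, map_evalL_eq_hornerZ ψ θ r hψ P]
      simp [hornerZ]

/-! ## Eisenstein series coefficients (integers) -/

/-- `σ(m) = Σ_{d ∣ m} d` for `m ≥ 1` (and `σ(0) = 0`), as a list computation. -/
def sigmaL (m : ℕ) : ℕ := (((List.range (m + 1)).filter fun d => decide (0 < d) && (m % d == 0)).map id).sum

/-- Coefficient of `q^m` in `E^{(t)} := E₂(z) − t·E₂(tz)` (`E₂ = 1 − 24 Σ_{m ≥ 1} σ(m) q^m`), a modular form of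
weight 2 on `Γ₀(N)` for `t ∣ N` [DS05, §4.6]: `a_0 = 1 − t`, `a_m = −24 (σ(m) − t·σ(m/t))` (`σ(m/t) := 0` if `t ∤ m`). -/
def eisT (t m : ℕ) : ℤ :=
  if m = 0 then 1 - (t : ℤ)
  else -24 * ((sigmaL m : ℤ) - if t ∣ m then (t : ℤ) * (sigmaL (m / t) : ℤ) else 0)

/-- Coefficient of `q^m` in the Eisenstein combination `G = Σ_{(t, λ_t) ∈ lam} λ_t · E^{(t)}`. -/
def eisCoeff (lam : List (ℕ × ℤ)) (m : ℕ) : ℤ := (lam.map fun tl => tl.2 * eisT tl.1 m).sum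

/-! ## Newform coefficients from eigenvalues (generic over a commutative ring) -/

/-- `a_{p^j}` from `c_p` by the weight-2, trivial-character newform recursion at level `N`:
`a_1 = 1`, `a_p = c_p`, `a_{p^{j+2}} = c_p · a_{p^{j+1}} − [p ∤ N] · p · a_{p^j}`. -/
def ppCoeff {R : Type} [CommRing R] (N : ℕ) (cp : R) (p : ℕ) : ℕ → R
  | 0 => 1
  | 1 => cp
  | j + 2 => cp * ppCoeff N cp p (j + 1) - (if p ∣ N then 0 else (p : R)) * ppCoeff N cp p j

/-- `a_m` for `m = ∏ p^j` given as a list of prime powers `fac`, by multiplicativity: `∏ a_{p^j}`. -/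
def coeffOfFac {R : Type} [CommRing R] (N : ℕ) (c : ℕ → R) (fac : List (ℕ × ℕ)) : R :=
  (fac.map fun pk => ppCoeff N (c pk.1) pk.1 pk.2).prod

/-- Ring homomorphisms commute with `ppCoeff`. -/
lemma map_ppCoeff {R S : Type} [CommRing R] [CommRing S] (φ : R →+* S) (N : ℕ) (cp : R) (p : ℕ) :
    ∀ j, φ (ppCoeff N cp p j) = ppCoeff N (φ cp) p j
  | 0 => by simp [ppCoeff]
  | 1 => by simp [ppCoeff]
  | j + 2 => by
      simp only [ppCoeff, map_sub, map_mul, map_ppCoeff φ N cp p (j + 1), map_ppCoeff φ N cp p j]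
      split <;> simp

/-- Ring homomorphisms commute with `coeffOfFac`. -/
lemma map_coeffOfFac {R S : Type} [CommRing R] [CommRing S] (φ : R →+* S) (N : ℕ) (c : ℕ → R) :
    ∀ fac : List (ℕ × ℕ), φ (coeffOfFac N c fac) = coeffOfFac N (fun p => φ (c p)) fac
  | [] => by simp [coeffOfFac]
  | pk :: fac => by
      have := map_coeffOfFac φ N c fac
      simp only [coeffOfFac, List.map_cons, List.prod_cons, map_mul] at this ⊢
      rw [this, map_ppCoeff]

/-- `coeffOfFac` only depends on the eigenvalues at the primes of the factorisation. -/
lemma coeffOfFac_congr {R : Type} [CommRing R] (N : ℕ) (c c' : ℕ → R) :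
    ∀ fac : List (ℕ × ℕ), (∀ pk ∈ fac, c pk.1 = c' pk.1) → coeffOfFac N c fac = coeffOfFac N c' fac
  | [], _ => rfl
  | pk :: fac, h => by
      have h1 : c pk.1 = c' pk.1 := h pk (by simp)
      have h2 := coeffOfFac_congr N c c' fac (fun q hq => h q (by simp [hq]))
      simp only [coeffOfFac, List.map_cons, List.prod_cons] at h2 ⊢
      rw [h1, h2]

/-! ## Factorisations and the Sturm bound -/

/-- `fac = [(p₁, j₁), …]` is a factorisation of `m` into powers of DISTINCT primes with exponents `≥ 1`. -/
def isFactorisation (m : ℕ) (fac : List (ℕ × ℕ)) : Bool :=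
  ((fac.map fun pk => pk.1 ^ pk.2).prod == m) && fac.all (fun pk => decide pk.1.Prime && decide (1 ≤ pk.2)) &&
    decide (fac.map Prod.fst).Nodup

/-- `ψ(N) = ∏ p^{j−1}(p+1)` over the prime factorisation of `N` — the index `[SL₂(ℤ) : Γ₀(N)]`. -/
def psiOfFac (fac : List (ℕ × ℕ)) : ℕ := (fac.map fun pk => pk.1 ^ (pk.2 - 1) * (pk.1 + 1)).prod

/-- `SturmReaches N B`: `B` is at least the weight-2 Sturm bound `ψ(N)/6` of `Γ₀(N)`, witnessed by a prime
factorisation of `N` (`6·B ≥ ψ(N)`). -/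
def SturmReaches (N B : ℕ) : Prop := ∃ facN : List (ℕ × ℕ), isFactorisation N facN = true ∧ psiOfFac facN ≤ 6 * B

/-! ## The model-side statement -/

/-- **`M.EisensteinCongruent f ψ lam B`** — the newform `f` (level `N`) is congruent, under `ψ : Coeff f → k`, to the
Eisenstein combination `G_λ = Σ λ_t E^{(t)}` (`t ∣ N`, `t > 1`) up to `q^B`: `a_0(G_λ) = 0` in `k` and, for every
`1 ≤ m ≤ B`, `ψ(a_m(f)) = a_m(G_λ)` in `k`, where `a_m(f)` is `coeffOfFac N (c_·(f))` of a prime factorisation of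
`m` (equal to the `m`-th Fourier coefficient in the intended model). -/
def NewformModel.EisensteinCongruent (M : NewformModel) {N : ℕ} (f : M.Form N) {k : Type} [Field k]
    (ψ : M.Coeff N f →+* k) (lam : List (ℕ × ℤ)) (B : ℕ) : Prop :=
  (∀ tl ∈ lam, tl.1 ∣ N ∧ 1 < tl.1) ∧ ((eisCoeff lam 0 : ℤ) : k) = 0 ∧
    ∀ m : ℕ, 1 ≤ m → m ≤ B → ∃ fac : List (ℕ × ℕ), isFactorisation m fac = true ∧
      ψ (coeffOfFac N (M.eig N f) fac) = ((eisCoeff lam m : ℤ) : k)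

/-! ## Certificates and the checker -/

/-- An Eisenstein-congruence certificate for one orbit: the prime `(n, θ − r)`, inverses `(p, d_p⁻¹ mod n)` for the
listed eigenvalue entries, the combination `λ = [(t, λ_t)]`, the number `B` of coefficients, the prime factorisation
of the level, and the prime factorisations of `1, …, B` (in this order). -/
structure EisCert where
  /-- the residue characteristic -/
  n : ℕ
  /-- `θ ≡ r (mod 𝔫)` -/
  r : ℤ
  /-- `(p, u_p)` with `d_p · u_p ≡ 1 (mod n)` -/
  dinv : List (ℕ × ℤ)
  /-- the Eisenstein combination `(t, λ_t)` -/
  lam : List (ℕ × ℤ)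
  /-- number of coefficients compared -/
  B : ℕ
  /-- prime factorisation of the level `N` -/
  facN : List (ℕ × ℕ)
  /-- prime factorisations of `m = 1, …, B` -/
  facs : List (List (ℕ × ℕ))

/-- The eigenvalue `c_p (mod 𝔫)` as an INTEGER representative `g_p(r) · u_p` (`u_p = d_p⁻¹ mod n`), or `none` if `p`
has no entry / no inverse. -/
def EisCert.eigAt (c : EisCert) (X : OrbitData) (p : ℕ) : Option ℤ :=
  match X.coeffs.find? (fun e => e.ell == p), c.dinv.find? (fun pu => pu.1 == p) with
  | some e, some pu => if (e.d * pu.2) % (c.n : ℤ) == 1 % (c.n : ℤ) then some (hornerZ e.g c.r * pu.2) else none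
  | _, _ => none

/-- Total version of `eigAt` (junk `0` where undefined; the checker verifies definedness where used). -/
def EisCert.eigZ (c : EisCert) (X : OrbitData) (p : ℕ) : ℤ := (c.eigAt X p).getD 0

/-- Check of one coefficient index `m` with factorisation `fac`: `fac` factorises `m`, every prime of `fac` has a
usable entry, and `a_m(f) ≡ a_m(G_λ) (mod n)` for the integer representatives. -/
def EisCert.checkAt (c : EisCert) (N : ℕ) (X : OrbitData) (m : ℕ) (fac : List (ℕ × ℕ)) : Bool :=
  isFactorisation m fac && fac.all (fun pk => (c.eigAt X pk.1).isSome) &&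
    ((coeffOfFac N (c.eigZ X) fac - eisCoeff c.lam m) % (c.n : ℤ) == 0)

/-- `checkAll c N X m facs`: `checkAt` for the indices `m, m+1, …` against the list `facs`. -/
def EisCert.checkAll (c : EisCert) (N : ℕ) (X : OrbitData) : ℕ → List (List (ℕ × ℕ)) → Bool
  | _, [] => true
  | m, fac :: facs => c.checkAt N X m fac && c.checkAll N X (m + 1) facs

/-- **The checker.** `λ` supported on divisors `t > 1` of `N`; `a_0(G_λ) ≡ 0 (mod n)`; `facN` factorises `N` with
`6·B ≥ ψ(N)`; exactly `B` factorisations; and `checkAt` for every `m = 1, …, B`. -/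
def EisCert.check (c : EisCert) (N : ℕ) (X : OrbitData) : Bool :=
  c.lam.all (fun tl => decide (tl.1 ∣ N) && decide (1 < tl.1)) && (eisCoeff c.lam 0 % (c.n : ℤ) == 0) &&
    isFactorisation N c.facN && decide (psiOfFac c.facN ≤ 6 * c.B) && (c.facs.length == c.B) &&
    c.checkAll N X 1 c.facs

/-! ## Soundness -/

/-- If `eigAt` returns `some v` then `p` has an entry `e` and an inverse `u` with `d_e·u ≡ 1 (mod n)` and
`v = g_e(r)·u`. -/
lemma EisCert.eigAt_spec (c : EisCert) (X : OrbitData) (p : ℕ) (v : ℤ) (h : c.eigAt X p = some v) :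
    ∃ e ∈ X.coeffs, ∃ u : ℤ, e.ell = p ∧ (e.d * u) % (c.n : ℤ) = 1 % (c.n : ℤ) ∧ v = hornerZ e.g c.r * u := by
  unfold EisCert.eigAt at h
  split at h
  · rename_i e pu he hpu
    by_cases hc : (e.d * pu.2) % (c.n : ℤ) == 1 % (c.n : ℤ)
    · rw [if_pos hc] at h
      simp only [Option.some.injEq] at h
      refine ⟨e, List.mem_of_find?_eq_some he, pu.2, ?_, by simpa using hc, h.symm⟩
      have := List.find?_some he
      simpa using this
    · rw [if_neg hc] at h
      simp at h
  · simp at h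

/-- In characteristic `n`, integers congruent mod `n` have equal images. -/
lemma intCast_eq_of_emod_eq {k : Type} [Field k] (n : ℕ) [CharP k n] {a b : ℤ} (h : (a - b) % (n : ℤ) = 0) :
    (a : k) = (b : k) := by
  have hd : (n : ℤ) ∣ a - b := Int.dvd_of_emod_eq_zero h
  have : ((a - b : ℤ) : k) = 0 := by
    rw [CharP.intCast_eq_zero_iff k n]
    exact hd
  rw [Int.cast_sub, sub_eq_zero] at this
  exact this

/-- The image of `c_p(f)` under `ψ` is the integer representative computed by the certificate. -/
lemma EisCert.map_eig_eq (c : EisCert) {N : ℕ} (X : OrbitData) (M : NewformModel) (f : M.Form N) (θ : M.Coeff N f)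
    (hθ : ∀ e ∈ X.coeffs, (e.d : M.Coeff N f) * M.eig N f e.ell = evalL θ e.g) {k : Type} [Field k] [CharP k c.n]
    (ψ : M.Coeff N f →+* k) (hψ : ψ θ = (c.r : k)) (p : ℕ) (v : ℤ) (hv : c.eigAt X p = some v) :
    ψ (M.eig N f p) = (v : k) := by
  obtain ⟨e, he, u, hep, hdu, rfl⟩ := c.eigAt_spec X p v hv
  have h1 : (e.d : k) * ψ (M.eig N f p) = ((hornerZ e.g c.r : ℤ) : k) := by
    rw [← hep, ← map_evalL_eq_hornerZ ψ θ c.r hψ e.g, ← hθ e he, map_mul, map_intCast]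
  have hdu' : ((e.d * u : ℤ) : k) = ((1 : ℤ) : k) :=
    intCast_eq_of_emod_eq c.n (by rw [Int.sub_emod, hdu, ← Int.sub_emod]; simp)
  rw [Int.cast_mul, Int.cast_one] at hdu'
  calc ψ (M.eig N f p) = ψ (M.eig N f p) * ((e.d : k) * (u : k)) := by rw [hdu', mul_one]
    _ = ((e.d : k) * ψ (M.eig N f p)) * (u : k) := by ring
    _ = ((hornerZ e.g c.r : ℤ) : k) * (u : k) := by rw [h1]
    _ = ((hornerZ e.g c.r * u : ℤ) : k) := by push_cast; ring

/-- One index: `checkAt = true` gives the congruence for `m` in `k`. -/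
lemma EisCert.checkAt_sound (c : EisCert) {N : ℕ} (X : OrbitData) (M : NewformModel) (f : M.Form N) (θ : M.Coeff N f)
    (hθ : ∀ e ∈ X.coeffs, (e.d : M.Coeff N f) * M.eig N f e.ell = evalL θ e.g) {k : Type} [Field k] [CharP k c.n]
    (ψ : M.Coeff N f →+* k) (hψ : ψ θ = (c.r : k)) (m : ℕ) (fac : List (ℕ × ℕ)) (h : c.checkAt N X m fac = true) :
    isFactorisation m fac = true ∧ ψ (coeffOfFac N (M.eig N f) fac) = ((eisCoeff c.lam m : ℤ) : k) := by
  simp only [EisCert.checkAt, Bool.and_eq_true, List.all_eq_true, beq_iff_eq] at h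
  obtain ⟨⟨hfac, hsome⟩, hcong⟩ := h
  refine ⟨hfac, ?_⟩
  rw [map_coeffOfFac]
  have hc : coeffOfFac N (fun p => ψ (M.eig N f p)) fac = coeffOfFac N (fun p => ((c.eigZ X p : ℤ) : k)) fac := by
    apply coeffOfFac_congr
    intro pk hpk
    have hs := hsome pk hpk
    obtain ⟨v, hv⟩ := Option.isSome_iff_exists.mp hs
    rw [c.map_eig_eq X M f θ hθ ψ hψ pk.1 v hv]
    simp [EisCert.eigZ, hv]
  rw [hc]
  have hcast : coeffOfFac N (fun p => ((c.eigZ X p : ℤ) : k)) fac = ((coeffOfFac N (c.eigZ X) fac : ℤ) : k) := by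
    have := map_coeffOfFac (Int.castRingHom k) N (c.eigZ X) fac
    simpa using this.symm
  rw [hcast]
  exact intCast_eq_of_emod_eq c.n hcong

/-- All indices: `checkAll m₀ facs = true` gives the congruence for `m₀ ≤ m < m₀ + |facs|`. -/
lemma EisCert.checkAll_sound (c : EisCert) {N : ℕ} (X : OrbitData) (M : NewformModel) (f : M.Form N) (θ : M.Coeff N f)
    (hθ : ∀ e ∈ X.coeffs, (e.d : M.Coeff N f) * M.eig N f e.ell = evalL θ e.g) {k : Type} [Field k] [CharP k c.n]
    (ψ : M.Coeff N f →+* k) (hψ : ψ θ = (c.r : k)) :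
    ∀ (facs : List (List (ℕ × ℕ))) (m₀ : ℕ), c.checkAll N X m₀ facs = true →
      ∀ m, m₀ ≤ m → m < m₀ + facs.length → ∃ fac, isFactorisation m fac = true ∧
        ψ (coeffOfFac N (M.eig N f) fac) = ((eisCoeff c.lam m : ℤ) : k)
  | [], m₀, _, m, h1, h2 => by simp at h2; omega
  | fac :: facs, m₀, h, m, h1, h2 => by
      simp only [EisCert.checkAll, Bool.and_eq_true] at h
      obtain ⟨hhead, htail⟩ := h
      by_cases hm : m = m₀
      · subst hm
        exact ⟨fac, c.checkAt_sound X M f θ hθ ψ hψ m fac hhead⟩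
      · exact c.checkAll_sound X M f θ hθ ψ hψ facs (m₀ + 1) htail m (by omega)
          (by simp only [List.length_cons] at h2; omega)

/-- **Soundness of the Eisenstein-congruence checker.** If `c.check N X = true`, then for every newform `f` of level
`N` carrying the data `X` with generator `θ` (`d_p · c_p(f) = g_p(θ)` for the listed entries) and every ring
homomorphism `ψ : Coeff f → k` to a field of characteristic `c.n` with `ψ(θ) = r`:
`M.EisensteinCongruent f ψ c.lam c.B` and `SturmReaches N c.B`. -/
theorem EisCert.check_sound (c : EisCert) {N : ℕ} (X : OrbitData) (h : c.check N X = true) (M : NewformModel)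
    (f : M.Form N) (θ : M.Coeff N f) (hθ : ∀ e ∈ X.coeffs, (e.d : M.Coeff N f) * M.eig N f e.ell = evalL θ e.g)
    {k : Type} [Field k] [CharP k c.n] (ψ : M.Coeff N f →+* k) (hψ : ψ θ = (c.r : k)) :
    M.EisensteinCongruent f ψ c.lam c.B ∧ SturmReaches N c.B := by
  simp only [EisCert.check, Bool.and_eq_true, List.all_eq_true, decide_eq_true_eq, beq_iff_eq] at h
  obtain ⟨⟨⟨⟨⟨hlam, h0⟩, hfacN⟩, hpsi⟩, hlen⟩, hall⟩ := h
  refine ⟨⟨fun tl htl => hlam tl htl, ?_, ?_⟩, ⟨c.facN, hfacN, hpsi⟩⟩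
  · have := intCast_eq_of_emod_eq (k := k) c.n (a := eisCoeff c.lam 0) (b := 0) (by simpa using h0)
    simpa using this
  · intro m h1 h2
    exact c.checkAll_sound X M f θ hθ ψ hψ c.facs 1 hall m h1 (by rw [hlen]; omega)

end Summit.Ventures.AbcSig
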